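import Mathlib
import Literature.NumberTheory.Transcendental.KZProductIdeal
import Literature.NumberTheory.Transcendental.KZLogCalculusProofs
import HarnessLib

/-!
# Green's formula on a Nash-edged rectangle band — a derived move of the Kontsevich–Zagier calculus

Theorem-only support file for the calculus of moves of `KZCalculus.lean` (`KZ.IntegralRep`,
`KZ.FormalRep`, `KZ.of`, the four move sets, `KZ.relations`), its bands `KZlog.band τ a b`
(`KZLogCalculus.lean`), coordinate relabelling `KZ.IntegralRep.reindex`
(`KZProductIdeal.lean`) and the swap of the last two coordinates (`KZ.init_comp_swap`,
`KZ.comp_swap_last`, `KZLogCalculusProofs.lean`). Kontsevich–Zagier's rule 3) in several variables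
reads «replace the Newton–Leibniz formula by Stokes's formula» [Kontsevich–Zagier 2001, §1.2]; the
calculus of `KZCalculus.lean` fixes rule 3) as Newton–Leibniz along the LAST coordinate of a band and
announces that planar Stokes reduces to it with rules 1), 2). This file carries out that reduction
for GREEN'S FORMULA ON A RECTANGLE BAND, fibred over an arbitrary semialgebraic base:

* `KZ.of_sub_of_mem_relations_green` — base `τ ⊆ ℝⁿ`; edges `α ≤ β`, `γ ≤ δ` `ℚ`-semialgebraic on `τ`;
  the rectangle band `R = {(x,u,v) | x ∈ τ, u ∈ [α x, β x], v ∈ [γ x, δ x]}` (`v` last); `P, Q`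
  `ℚ`-semialgebraic on `R` with `rP = [R, ∂ᵥP]`, `rQ = [R, ∂ᵤQ]` in the fibrewise sense of rule 3)
  (continuity of `P(x,u,·)`, `Q(x,·,v)` on the closed fibres, derivative = the integrand on the open
  fibres) and CLOSEDNESS `∂ᵤQ = ∂ᵥP` on `R`. Then the two boundary representations
  `bQ = [τ ×_γ^δ, Q(x,β x,v) − Q(x,α x,v)]` and `bP = [τ ×_α^β, P(x,u,δ x) − P(x,u,γ x)]` satisfy
  `[bQ] − [bP] ∈ KZ.relations`, i.e. `∮_{∂R(x)} (P du + Q dv) ≡ 0` fibrewise. Proof: Newton–Leibniz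
  along `v` for `P` (primitive `P` itself), the coordinate swap `(x,u,v) ↦ (x,v,u)`
  (`KZ.of_sub_of_reindex_mem_relations`, rule 2)), Newton–Leibniz along `u` for `Q` (primitive `Q`),
  and integrand congruence (`KZ.of_sub_of_mem_relations_of_eqOn`). No transcendental primitive
  enters — the primitives are `P`, `Q` themselves — which is why planar Cauchy/Stokes for rational or
  Nash forms is available inside the period calculus although, e.g., `∫ du/(u²+1)` has no algebraic
  primitive.
* `comp_swap_snoc`, `setOf_comp_swap_mem_rect` (private helpers) — the swap of the last two
  coordinates on points `((x, v), t)` and on rectangle bands.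

Provenance. Typed for the root decomposition cell `decomp-kz` of `KontsevichZagierPeriods` (lens 2,
generation 4; line «argument principle inside the moves» for the crux `PiRationalisation` of route
RootDecompRationalCubeDichotomy, item 24903). Source, kernel-checked there (rc 0, no placeholders,
standard axioms; Literature imports only) and copied verbatim modulo the namespace:
`run/shared/lean/pub/decomp-kz/decomp-kz-lens-2/g4/scratch/PlanarStokes.lean`
(sha256 `7ff47d9fd809fb4f…`, 136 lines).

Everything is proved; no `def`, no named fact.

## References

* M. Kontsevich, D. Zagier, *Periods*, in: Mathematics Unlimited — 2001 and Beyond, Springer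
  (2001), §1.2, rules 2), 3) («replace the Newton–Leibniz formula by Stokes's formula»).
  [`KontsevichZagier2001`]
-/

noncomputable section

open MeasureTheory Set

namespace Literature.NumberTheory.Transcendental

open Literature.ModelTheory.ExponentialFields (IsSemialgebraic)

namespace KZ

/-! ### Swapping the last two coordinates on rectangle bands -/

open Literature.ModelTheory.ExponentialFields (IsSemialgebraic)

/-- Swapping the last two coordinates of `(y, t)`, `y = (x, v)`: the result is `((x, t), v)`. (Source: cell
`decomp-kz`, lens 2 gen 4, `g4/scratch/PlanarStokes.lean`, sha256 `7ff47d9f…`, l. 30.) [folklore] -/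
private theorem comp_swap_snoc {n : ℕ} (y : Fin (n + 1) → ℝ) (t : ℝ) :
    (fun i => (Fin.snoc y t : Fin (n + 2) → ℝ)
        (Equiv.swap (Fin.castSucc (Fin.last n)) (Fin.last (n + 1)) i)) =
      Fin.snoc (Fin.snoc (Fin.init y) t : Fin (n + 1) → ℝ) (y (Fin.last n)) := by
  have h1 := init_comp_swap (n := n) (Fin.snoc y t : Fin (n + 2) → ℝ)
  have h2 := comp_swap_last (n := n) (Fin.snoc y t : Fin (n + 2) → ℝ)
  simp only [Fin.init_snoc, Fin.snoc_last, Fin.snoc_castSucc] at h1 h2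
  rw [← Fin.snoc_init_self (fun i => (Fin.snoc y t : Fin (n + 2) → ℝ)
    (Equiv.swap (Fin.castSucc (Fin.last n)) (Fin.last (n + 1)) i)), h1, h2]

/-- The rectangle band `{(x,u,v)}` read in the coordinates `(x,v,u)` is the rectangle band with the
edge pairs exchanged. (Source: cell `decomp-kz`, lens 2 gen 4, `g4/scratch/PlanarStokes.lean`,
sha256 `7ff47d9f…`, l. 42.) [folklore] -/
private theorem setOf_comp_swap_mem_rect {n : ℕ} (τ : Set (Fin n → ℝ)) (α β γ δ : (Fin n → ℝ) → ℝ) :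
    {w : Fin (n + 2) → ℝ | (fun i => w (Equiv.swap (Fin.castSucc (Fin.last n)) (Fin.last (n + 1)) i))
        ∈ KZlog.band (KZlog.band τ α β) (fun y => γ (Fin.init y)) (fun y => δ (Fin.init y))} =
      KZlog.band (KZlog.band τ γ δ) (fun y => α (Fin.init y)) (fun y => β (Fin.init y)) := by
  ext w
  simp only [mem_setOf_eq, KZlog.mem_band, init_comp_swap, comp_swap_last, Fin.init_snoc,
    Fin.snoc_last]
  simp only [Fin.init]
  tauto

/-! ### Green's formula on a rectangle band -/

/-- **Green's formula on a Nash-edged rectangle band, inside KZ's moves.** Base `τ ⊆ ℝⁿ`; edges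
`α ≤ β`, `γ ≤ δ` `ℚ`-semialgebraic on `τ`; the rectangle band `R = {(x,u,v) | x ∈ τ, u ∈ [α x, β x],
v ∈ [γ x, δ x]}` (`v` last); `P, Q` `ℚ`-semialgebraic on `R`; `rP = [R, ∂ᵥP]`, `rQ = [R, ∂ᵤQ]` in the
precise fibrewise sense of KZ's rule 3) (continuity of `P(x,u,·)` / `Q(x,·,v)` on the closed fibres,
derivative = the integrand on the open fibres); CLOSEDNESS `∂ᵤQ = ∂ᵥP` on `R` (as `rQ.integrand = rP.integrand`
on `R`). Then the boundary representations `bQ = [τ ×_γ^δ, Q(x,β x,v) − Q(x,α x,v)]` and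
`bP = [τ ×_α^β, P(x,u,δ x) − P(x,u,γ x)]` satisfy `[bQ] − [bP] ∈ relations`, i.e.
`∮_{∂R(x)} (P du + Q dv) ≡ 0` fibrewise: Newton–Leibniz along `v` for `P`, the coordinate swap
`(x,u,v) ↦ (x,v,u)` (rule 2), Newton–Leibniz along `u` for `Q`, and integrand congruence. (Source: cell
`decomp-kz`, lens 2 gen 4, `g4/scratch/PlanarStokes.lean`, sha256 `7ff47d9f…`, l. 66; Kontsevich–Zagier 2001, §1.2: «replace the Newton–Leibniz formula by Stokes's
formula».) [cite: KontsevichZagier2001, §1.2 rule 3] -/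
theorem of_sub_of_mem_relations_green {n : ℕ} {τ : Set (Fin n → ℝ)} {α β γ δ : (Fin n → ℝ) → ℝ}
    (P Q : (Fin (n + 2) → ℝ) → ℝ)
    (hα : IsSemialgebraicFunOn ℚ τ α) (hβ : IsSemialgebraicFunOn ℚ τ β)
    (hγ : IsSemialgebraicFunOn ℚ τ γ) (hδ : IsSemialgebraicFunOn ℚ τ δ)
    (hαβ : ∀ x ∈ τ, α x ≤ β x) (hγδ : ∀ x ∈ τ, γ x ≤ δ x)
    (rP rQ : IntegralRep (n + 2)) (bP bQ : IntegralRep (n + 1))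
    (hrPd : rP.domain =
      KZlog.band (KZlog.band τ α β) (fun y => γ (Fin.init y)) (fun y => δ (Fin.init y)))
    (hrQd : rQ.domain = rP.domain)
    (hPsa : IsSemialgebraicFunOn ℚ rP.domain P) (hQsa : IsSemialgebraicFunOn ℚ rP.domain Q)
    (hPcont : ∀ y ∈ KZlog.band τ α β,
      ContinuousOn (fun t : ℝ => P (Fin.snoc y t)) (Icc (γ (Fin.init y)) (δ (Fin.init y))))
    (hPder : ∀ y ∈ KZlog.band τ α β, ∀ t ∈ Ioo (γ (Fin.init y)) (δ (Fin.init y)),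
      HasDerivAt (fun s : ℝ => P (Fin.snoc y s)) (rP.integrand (Fin.snoc y t)) t)
    (hQcont : ∀ y ∈ KZlog.band τ γ δ,
      ContinuousOn (fun t : ℝ => Q (Fin.snoc (Fin.snoc (Fin.init y) t : Fin (n + 1) → ℝ) (y (Fin.last n))))
        (Icc (α (Fin.init y)) (β (Fin.init y))))
    (hQder : ∀ y ∈ KZlog.band τ γ δ, ∀ t ∈ Ioo (α (Fin.init y)) (β (Fin.init y)),
      HasDerivAt (fun s : ℝ => Q (Fin.snoc (Fin.snoc (Fin.init y) s : Fin (n + 1) → ℝ) (y (Fin.last n))))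
        (rQ.integrand (Fin.snoc (Fin.snoc (Fin.init y) t : Fin (n + 1) → ℝ) (y (Fin.last n)))) t)
    (hclosed : EqOn rQ.integrand rP.integrand rP.domain)
    (hbPd : bP.domain = KZlog.band τ α β)
    (hbPi : ∀ y ∈ bP.domain,
      bP.integrand y = P (Fin.snoc y (δ (Fin.init y))) - P (Fin.snoc y (γ (Fin.init y))))
    (hbQd : bQ.domain = KZlog.band τ γ δ)
    (hbQi : ∀ y ∈ bQ.domain, bQ.integrand y =
      Q (Fin.snoc (Fin.snoc (Fin.init y) (β (Fin.init y)) : Fin (n + 1) → ℝ) (y (Fin.last n))) -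
        Q (Fin.snoc (Fin.snoc (Fin.init y) (α (Fin.init y)) : Fin (n + 1) → ℝ) (y (Fin.last n)))) :
    of bQ - of bP ∈ relations := by
  -- (1) Newton–Leibniz along `v` for `P`
  have h1 : of rP - of bP ∈ relations := by
    refine newtonLeibnizRel_subset_relations ⟨n + 1, rP, bP, fun y => γ (Fin.init y),
      fun y => δ (Fin.init y), P, hPsa,
      hγ.comp_init_mono bP.isSemialgebraic_domain (hbPd ▸ band_subset_setOf_init_mem),
      hδ.comp_init_mono bP.isSemialgebraic_domain (hbPd ▸ band_subset_setOf_init_mem),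
      fun y hy => hγδ _ (hbPd ▸ hy).1, by rw [hrPd, hbPd]; rfl,
      fun y hy => hPcont y (hbPd ▸ hy), fun y hy t ht => hPder y (hbPd ▸ hy) t ht,
      fun y hy => hbPi y hy, rfl⟩
  -- (2) the coordinate swap `(x,u,v) ↦ (x,v,u)`
  have h2 : of rQ - of (rQ.reindex (Equiv.swap (Fin.castSucc (Fin.last n)) (Fin.last (n + 1)))) ∈
      relations := of_sub_of_reindex_mem_relations rQ _
  have hdom' : (rQ.reindex (Equiv.swap (Fin.castSucc (Fin.last n)) (Fin.last (n + 1)))).domain =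
      KZlog.band (KZlog.band τ γ δ) (fun y => α (Fin.init y)) (fun y => β (Fin.init y)) := by
    rw [IntegralRep.reindex_domain, hrQd, hrPd, setOf_comp_swap_mem_rect]
  -- (3) Newton–Leibniz along `u` for `Q`, on the swapped band
  have hQsa' : IsSemialgebraicFunOn ℚ rQ.domain Q := by rw [hrQd]; exact hQsa
  have h3 : of (rQ.reindex (Equiv.swap (Fin.castSucc (Fin.last n)) (Fin.last (n + 1)))) - of bQ ∈
      relations := by
    refine newtonLeibnizRel_subset_relations ⟨n + 1, _, bQ, fun y => α (Fin.init y),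
      fun y => β (Fin.init y),
      fun w => Q (fun i => w (Equiv.swap (Fin.castSucc (Fin.last n)) (Fin.last (n + 1)) i)),
      hQsa'.comp_equiv _,
      hα.comp_init_mono bQ.isSemialgebraic_domain (hbQd ▸ band_subset_setOf_init_mem),
      hβ.comp_init_mono bQ.isSemialgebraic_domain (hbQd ▸ band_subset_setOf_init_mem),
      fun y hy => hαβ _ (hbQd ▸ hy).1, by rw [hdom', hbQd]; rfl,
      fun y hy => ?_, fun y hy t ht => ?_, fun y hy => ?_, rfl⟩
    · simp only [comp_swap_snoc]
      exact hQcont y (hbQd ▸ hy)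
    · simp only [IntegralRep.reindex_integrand, comp_swap_snoc]
      exact hQder y (hbQd ▸ hy) t ht
    · simp only [comp_swap_snoc]
      exact hbQi y hy
  -- (4) closedness: `[R, ∂ᵤQ] ≡ [R, ∂ᵥP]`
  have h4 : of rQ - of rP ∈ relations :=
    of_sub_of_mem_relations_of_eqOn hrQd.symm (by rw [hrQd]; exact hclosed)
  have : of bQ - of bP =
      -(of (rQ.reindex (Equiv.swap (Fin.castSucc (Fin.last n)) (Fin.last (n + 1)))) - of bQ) -
        (of rQ - of (rQ.reindex (Equiv.swap (Fin.castSucc (Fin.last n)) (Fin.last (n + 1))))) +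
        (of rQ - of rP) + (of rP - of bP) := by abel
  rw [this]
  exact relations.add_mem (relations.add_mem (relations.sub_mem (relations.neg_mem h3) h2) h4) h1


end KZ

end Literature.NumberTheory.Transcendental
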